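import Summits.QuantumAdvantage.QuantumAdvantage.Theorems.CubicForrelationNearExactIsExactKtGapStep

/-!
# Crux `CubicForrelation.NearExactIsExact` (stmt-QuantumAdvantage-14043) — the Kasami–Tokura gap of cubics: no Boolean function of
  degree `≤ 3` on `m ≤ 16` bits has weight strictly between `3·2^{m-4}` and `7·2^{m-5}`; in particular NO CUBIC ON 12 BITS HAS
  WEIGHT IN `(768, 896)` (and none on 14 bits in `(3072, 3584)`, none on 16 bits in `(12288, 14336)`)

Certificate seat `b2b-cforr-cert` (gen 16).  HONEST FRAMING: a coding-theory BRICK (standard axioms, no `decide`), the formal substitute for the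
part of the Kasami–Tokura classification (1970: the weights of `RM(r,m)` below `2d` are `2d − 2d/2^μ`) that the TYPE-O branch of the `n = 12` window
analysis needs below `940/1024`: there a type-O side has a cubic base set `E` with `768 < #E`, and the budget `4096 + 8·#E ≤ 2¹⁷(1 − Φ)` only bites
again at `#E ≥ 896`.  The tree had the gap values `784 … 816` (`to15_weight_gap_none`, Fourier moments); `832 … 880` were open.  NOT summit progress.

Method (induction on `m`, `…KtGapTools`).  Let `c` be cubic on `m = k + 5` bits with `6·2^k < w = #E < 7·2^k`, `t = w − 6·2^k`, and assume the gap
on `k + 4` bits.  (i) Every derivative `c ⊕ c(·⊕a)` is a plateaued quadratic with Walsh value `> 2^m/8` at `0`, so `I(a) = #(E ∩ (E⊕a)) ∈ {t, 2·2^k + t, w}`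
and `2·2^k ∣ w²`.  (ii) A period `a ≠ 0` (`I(a) = w`) would make `c` descend to `k + 4` bits with weight `w/2` inside the smaller gap — so there is
none.  (iii) For `z ≠ 0` the two halves `#(E ∩ {⟨x,z⟩ = b})` are weights of cubics on `k + 4` bits (`ktg_restrict`), hence (second weight + the
smaller gap) in `{0, 2·2^k, 3·2^k} ∪ [3.5·2^k, ∞)`, and they add up to `w < 7·2^k`: so `F(z) = Σ_E (−1)^{x·z} ∈ {±t, ±(2·2^k + t)}` (`±w` is excluded
since `E` lies in no hyperplane).  (iv) Parseval `Σ F² = 2^m w`, the fourth moment `Σ F⁴ = 2^m Σ_a I(a)²` and `Σ_a I(a) = w²` then give the linear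
Diophantine system `ktg_step` in the multiplicities `A, B, n₁, n₂`; for `k ≤ 11` it has no solution (`ktg_no_solution`: `t² ≥ 8·2^k` is killed by
Parseval alone, the single residual `t` by integrality of `B` (`k = 4, 5, 6, 8, …, 11`) or by the fourth moment (`k = 3, 7`); `k ≤ 2` has no
admissible `t`).  Base `m ≤ 4`: the interval is empty.

Main statements: `kt_gap_cubic_le_sixteen` (all `m ≤ 16`), `kt_gap_twelve` / `kt_gap_fourteen` / `kt_gap_sixteen`, and the type-O consequence
`to16_typeO_le_936` (a type-O side on 12 bits has `Φ ≤ 936/1024`; the tree had `940/1024`).  The level-`≥ 6` branch below `941/1024` is NOT treated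
here, so NO new value of `θ₁₂` is claimed.

References: T. Kasami, N. Tokura, *On the weight structure of Reed–Muller codes*, IEEE Trans. IT 16 (1970) 752–759 (Thm 1); F. J. MacWilliams,
N. J. A. Sloane (1977) Ch. 15 §3 Thm 8; R. O'Donnell (2014) §3.3.  Everything below is proved from Mathlib and the tree; axioms are the standard three.
-/

set_option linter.dupNamespace false -- D-0017: single-problem summit ⇒ `QuantumAdvantage.QuantumAdvantage` by design

noncomputable section

namespace Summit.QuantumAdvantage.QuantumAdvantage.Theorems.CubicForrelation.NearExactIsExact

open Finset
open Literature.Computability.QuantumComplexity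
open Literature.Computability.QuantumComplexity.BuzetChailloux (bxor zeroVec bxor_bxor_cancel_left bxor_zeroVec zeroVec_bxor bxor_comm
  bxor_self twist_zeroVec_right twist_bxor_right)
open Literature.Computability.QuantumComplexity.DerivativeWalsh (W twist_bxor_left)
open Literature.Computability.QuantumComplexity.Simon (twist_eq_one_or)
open Summit.QuantumAdvantage.QuantumAdvantage.Theorems.NearExactIsExact.Negative (TypeOTwelve.typeO_of_exists_odd)
/-! ### The Diophantine system has no solution for `k ≤ 11` (`m ≤ 16`) -/

/-- **Parseval kills `t² ≥ 8·2^k`**: with `A + B + 1 = 32·2^k` and `A t² + B (2·2^k + t)² + w² = 32·2^k·w`, `w = 6·2^k + t < 7·2^k`,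
the lower bound `(A + B) t² ≤ 32·2^k·w − w²` forces `t² < 8·2^k`. [this work] -/
theorem ktg_t_sq_lt (k w t A B : ℕ) (hw : w = 6 * 2 ^ k + t) (h2 : w < 7 * 2 ^ k) (hAB : A + B + 1 = 32 * 2 ^ k)
    (hP : A * t ^ 2 + B * (2 * 2 ^ k + t) ^ 2 + w ^ 2 = 32 * 2 ^ k * w) : t * t < 8 * 2 ^ k := by
  by_contra hge
  push Not at hge
  have hP' : (A + B) * (t * t) + w * w ≤ 32 * 2 ^ k * w := by
    have h1 : B * (t * t) ≤ B * ((2 * 2 ^ k + t) * (2 * 2 ^ k + t)) :=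
      Nat.mul_le_mul_left _ (Nat.mul_le_mul (by omega) (by omega))
    nlinarith [hP]
  -- `(A + B) t² ≥ (32·2^k − 1)·8·2^k` while `32·2^k·w − w² < 32·2^k · 7·2^k − w²`
  have hP2 : 2 ^ k ≥ 1 := Nat.one_le_two_pow
  have hAB' : A + B = 32 * 2 ^ k - 1 := by omega
  rw [hAB'] at hP'
  have h3 : (32 * 2 ^ k - 1) * (8 * 2 ^ k) ≤ (32 * 2 ^ k - 1) * (t * t) := Nat.mul_le_mul_left _ hge
  have h4 : 32 * 2 ^ k * w < 32 * 2 ^ k * (7 * 2 ^ k) := Nat.mul_lt_mul_of_pos_left h2 (by omega)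
  -- combine: (32P − 1)·8P + w² ≤ 32P·w < 224 P², but (32P − 1) 8P = 256 P² − 8P and w² > 36 P²
  have h5 : w * w ≥ 36 * (2 ^ k * 2 ^ k) := by rw [hw]; nlinarith
  zify [hP2] at *
  nlinarith [h3, h4, h5, hP']
set_option maxHeartbeats 400000 in
/-- **No solution for `k ≤ 11`.**  The system of `ktg_step` has no solution in naturals when `k ≤ 11` (`m ≤ 16`): `t² < 8·2^k` by Parseval
(`ktg_t_sq_lt`), `2·2^k ∣ w²` leaves one residual `t` per `k ≥ 3` (`t = 4, 8, 8, 16, 16, 32, 32, 64, 64`), killed by integrality of `B`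
(`k = 4, 5, 6, 8, 9, 10, 11`) or by the fourth-moment identity (`k = 3`: `w = 52` on 8 bits; `k = 7`: `w = 784` on 12 bits); `k ≤ 2` has no
admissible `t > 0`. [this work] -/
theorem ktg_no_solution (k : ℕ) (hk : k ≤ 11) (w t A B n₁ n₂ : ℕ) (hw : w = 6 * 2 ^ k + t) (ht : 0 < t) (h2 : w < 7 * 2 ^ k)
    (hdvd : 2 * 2 ^ k ∣ w * w) (hAB : A + B + 1 = 32 * 2 ^ k)
    (hP : A * t ^ 2 + B * (2 * 2 ^ k + t) ^ 2 + w ^ 2 = 32 * 2 ^ k * w) (hn : n₁ + n₂ + 1 = 32 * 2 ^ k)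
    (hI : n₁ * (2 * 2 ^ k + t) + n₂ * t + w = w ^ 2)
    (h4 : w ^ 4 + A * t ^ 4 + B * (2 * 2 ^ k + t) ^ 4 = 32 * 2 ^ k * (w ^ 2 + n₁ * (2 * 2 ^ k + t) ^ 2 + n₂ * t ^ 2)) : False := by
  have htt := ktg_t_sq_lt k w t A B hw h2 hAB hP
  interval_cases k
  · -- k = 0: t < 1
    omega
  · -- k = 1: `4 ∣ w²` ⇒ `2 ∣ w`, `t < 2`
    have h2w : 2 ^ 1 ∣ w := by have := ktg_two_pow_dvd_of_sq (a := 2) (by simpa using hdvd); simpa using this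
    omega
  · -- k = 2: `8 ∣ w²` ⇒ `4 ∣ w`, `t < 4`
    have h4w : 2 ^ 2 ∣ w := by have := ktg_two_pow_dvd_of_sq (a := 3) (by simpa using hdvd); simpa using this
    omega
  · -- k = 3 (m = 8): `16 ∣ w²` ⇒ `4 ∣ w`; `t² < 64`; residual `t = 4`, `w = 52`: fourth moment
    have h4w : 2 ^ 2 ∣ w := by have := ktg_two_pow_dvd_of_sq (a := 4) (by simpa using hdvd); simpa using this
    have ht8 : t < 8 := by nlinarith
    obtain ⟨q, rfl⟩ : ∃ q, t = 4 * q := ⟨t / 4, by omega⟩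
    have hq : q < 2 := by omega
    interval_cases q
    · omega
    · subst hw; norm_num at hP hI h4 hAB hn; omega
  · -- k = 4 (m = 9): `32 ∣ w²` ⇒ `8 ∣ w`; `t² < 128`; residual `t = 8`, `w = 104`: `B` is not integral
    have h8w : 2 ^ 3 ∣ w := by have := ktg_two_pow_dvd_of_sq (a := 5) (by simpa using hdvd); simpa using this
    have ht12 : t < 12 := by nlinarith
    obtain ⟨q, rfl⟩ : ∃ q, t = 8 * q := ⟨t / 8, by omega⟩
    have hq : q < 2 := by omega
    interval_cases q
    · omega
    · subst hw; norm_num at hP hAB; omega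
  · -- k = 5 (m = 10): `64 ∣ w²` ⇒ `8 ∣ w`; `t² < 256`; residual `t = 8`, `w = 200`
    have h8w : 2 ^ 3 ∣ w := by have := ktg_two_pow_dvd_of_sq (a := 6) (by simpa using hdvd); simpa using this
    have ht16 : t < 16 := by nlinarith
    obtain ⟨q, rfl⟩ : ∃ q, t = 8 * q := ⟨t / 8, by omega⟩
    have hq : q < 2 := by omega
    interval_cases q
    · omega
    · subst hw; norm_num at hP hAB; omega
  · -- k = 6 (m = 11): `128 ∣ w²` ⇒ `16 ∣ w`; `t² < 512`; residual `t = 16`, `w = 400`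
    have h16w : 2 ^ 4 ∣ w := by have := ktg_two_pow_dvd_of_sq (a := 7) (by simpa using hdvd); simpa using this
    have ht23 : t < 23 := by nlinarith
    obtain ⟨q, rfl⟩ : ∃ q, t = 16 * q := ⟨t / 16, by omega⟩
    have hq : q < 2 := by omega
    interval_cases q
    · omega
    · subst hw; norm_num at hP hAB; omega
  · -- k = 7 (m = 12): `256 ∣ w²` ⇒ `16 ∣ w`; `t² < 1024`; residual `t = 16`, `w = 784`: fourth moment
    have h16w : 2 ^ 4 ∣ w := by have := ktg_two_pow_dvd_of_sq (a := 8) (by simpa using hdvd); simpa using this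
    have ht32 : t < 32 := by nlinarith
    obtain ⟨q, rfl⟩ : ∃ q, t = 16 * q := ⟨t / 16, by omega⟩
    have hq : q < 2 := by omega
    interval_cases q
    · omega
    · subst hw; norm_num at hP hI h4 hAB hn; omega
  · -- k = 8 (m = 13): `512 ∣ w²` ⇒ `32 ∣ w`; `t² < 2048`; residual `t = 32`, `w = 1568`: `B` is not integral
    have h32w : 2 ^ 5 ∣ w := by have := ktg_two_pow_dvd_of_sq (a := 9) (by simpa using hdvd); simpa using this
    have ht46 : t < 46 := by nlinarith
    obtain ⟨q, rfl⟩ : ∃ q, t = 32 * q := ⟨t / 32, by omega⟩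
    have hq : q < 2 := by omega
    interval_cases q
    · omega
    · subst hw; norm_num at hP hAB; omega
  · -- k = 9 (m = 14): `1024 ∣ w²` ⇒ `32 ∣ w`; `t² < 4096`; residual `t = 32`, `w = 3104`
    have h32w : 2 ^ 5 ∣ w := by have := ktg_two_pow_dvd_of_sq (a := 10) (by simpa using hdvd); simpa using this
    have ht64 : t < 64 := by nlinarith
    obtain ⟨q, rfl⟩ : ∃ q, t = 32 * q := ⟨t / 32, by omega⟩
    have hq : q < 2 := by omega
    interval_cases q
    · omega
    · subst hw; norm_num at hP hAB; omega
  · -- k = 10 (m = 15): `2048 ∣ w²` ⇒ `64 ∣ w`; `t² < 8192`; residual `t = 64`, `w = 6208`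
    have h64w : 2 ^ 6 ∣ w := by have := ktg_two_pow_dvd_of_sq (a := 11) (by simpa using hdvd); simpa using this
    have ht91 : t < 91 := by nlinarith
    obtain ⟨q, rfl⟩ : ∃ q, t = 64 * q := ⟨t / 64, by omega⟩
    have hq : q < 2 := by omega
    interval_cases q
    · omega
    · subst hw; norm_num at hP hAB; omega
  · -- k = 11 (m = 16): `4096 ∣ w²` ⇒ `64 ∣ w`; `t² < 16384`; residual `t = 64`, `w = 12352`
    have h64w : 2 ^ 6 ∣ w := by have := ktg_two_pow_dvd_of_sq (a := 12) (by simpa using hdvd); simpa using this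
    have ht128 : t < 128 := by nlinarith
    obtain ⟨q, rfl⟩ : ∃ q, t = 64 * q := ⟨t / 64, by omega⟩
    have hq : q < 2 := by omega
    interval_cases q
    · omega
    · subst hw; norm_num at hP hAB; omega

/-! ### The gap, by induction on `m ≤ 16` -/

/-- **The Kasami–Tokura gap of cubics for `m ≤ 16`.**  No Boolean function of degree `≤ 3` on `m ≤ 16` bits has
`3·2^m < 16·#{c = 1}` and `32·#{c = 1} < 7·2^m`, i.e. weight strictly between `1.5 d` and `1.75 d`, `d = 2^{m-3}`.
(Kasami–Tokura 1970 prove this for every `m`; the induction below is uniform except for the closing arithmetic `ktg_no_solution`, done here up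
to `m = 16` so that the brick also serves the slices `n = 14, 16`.)  NOT summit progress. [this work; cite: KasamiTokura1970 Thm 1,
MacWilliamsSloane1977 Ch. 15 §3] -/
theorem kt_gap_cubic_le_sixteen : ∀ m ≤ 16, ∀ c : (Fin m → Bool) → Bool, IsDegLeFun 3 c →
    ¬ (3 * 2 ^ m < 16 * #(univ.filter fun x => c x = true) ∧ 32 * #(univ.filter fun x => c x = true) < 7 * 2 ^ m) := by
  intro m
  induction m with
  | zero => intro _ c _ h; simp only [pow_zero] at h; omega
  | succ m ihm =>
    intro hm c hc h
    rcases Nat.lt_or_ge m 4 with hm4 | hm4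
    · -- `m + 1 ≤ 4`: the interval is empty
      obtain ⟨h1, h2⟩ := h
      interval_cases m <;> norm_num at h1 h2 <;> omega
    · obtain ⟨k, rfl⟩ : ∃ k, m = k + 4 := ⟨m - 4, by omega⟩
      have hk : k ≤ 11 := by omega
      have hN : 2 ^ (k + 4 + 1) = 32 * 2 ^ k := by ring
      rw [hN] at h
      have ih' : ∀ c' : (Fin (k + 4) → Bool) → Bool, IsDegLeFun 3 c' →
          ¬ (3 * 2 ^ k < #(univ.filter fun y => c' y = true) ∧ 2 * #(univ.filter fun y => c' y = true) < 7 * 2 ^ k) := by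
        intro c' hc' h'
        have hN4 : 2 ^ (k + 4) = 16 * 2 ^ k := by ring
        refine ihm (by omega) c' hc' ?_
        rw [hN4]; omega
      obtain ⟨w, t, A, B, n₁, n₂, hwS, hwt, hdvd, hAB, hP, hn, hI, h4⟩ :=
        ktg_step k ih' c hc (by omega) (by omega)
      exact ktg_no_solution k hk w t A B n₁ n₂ hwt (by omega) (by omega) hdvd hAB hP hn hI h4

/-- **No cubic Boolean function on 12 bits has weight in `(768, 896)`** (the values `776, …, 888`; Kasami–Tokura: the weights of `RM(3,12)`
below `1024` are `0, 512, 768, 896, 960, 992`).  Finite-slice statement; NOT summit progress. [this work] -/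
theorem kt_gap_twelve (c : (Fin (6 + 6) → Bool) → Bool) (hc : IsDegLeFun 3 c)
    (h1 : 768 < #(univ.filter fun x => c x = true)) (h2 : #(univ.filter fun x => c x = true) < 896) : False :=
  kt_gap_cubic_le_sixteen (6 + 6) (by norm_num) c hc ⟨by norm_num; omega, by norm_num; omega⟩

/-- **No cubic Boolean function on 14 bits has weight in `(3072, 3584)`** (for the type-O branch of the `n = 14` slice).  NOT summit progress.
[this work] -/
theorem kt_gap_fourteen (c : (Fin (7 + 7) → Bool) → Bool) (hc : IsDegLeFun 3 c)
    (h1 : 3072 < #(univ.filter fun x => c x = true)) (h2 : #(univ.filter fun x => c x = true) < 3584) : False :=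
  kt_gap_cubic_le_sixteen (7 + 7) (by norm_num) c hc ⟨by norm_num; omega, by norm_num; omega⟩

/-- **No cubic Boolean function on 16 bits has weight in `(12288, 14336)`** (for the type-O branch of the `n = 16` slice).  NOT summit progress.
[this work] -/
theorem kt_gap_sixteen (c : (Fin (8 + 8) → Bool) → Bool) (hc : IsDegLeFun 3 c)
    (h1 : 12288 < #(univ.filter fun x => c x = true)) (h2 : #(univ.filter fun x => c x = true) < 14336) : False :=
  kt_gap_cubic_le_sixteen (8 + 8) (by norm_num) c hc ⟨by norm_num; omega, by norm_num; omega⟩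

/-! ### The type-O ceiling `936/1024` at `n = 12` -/

/-- **A type-O side has `Φ ≤ 936/1024` (12 bits).**  Cubic `f, g : 𝔽₂¹² → 𝔽₂` with `W_g = 16u` and some `u(x)` odd: `Φ(f,g) ≤ 936/1024`.
(Above it the base energy `4096 + 8#E ≤ 2¹⁷(1 − Φ) < 11264` forces `#E < 896`; `#E ≥ 768` (`to15_typeO_E_ge_768`), `#E ≠ 768`
(`to15_typeO_E768_le`), and the gap `(768, 896)` (`kt_gap_twelve`) leave nothing.)  The tree had `940/1024` (`to15_typeO_le_940`).  The
level-`≥ 6` branch below `941/1024` is NOT treated, so no new value of `θ₁₂` follows yet.  Finite-slice statement; NOT summit progress. [this work] -/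
theorem to16_typeO_le_936 (f g : (Fin (6 + 6) → Bool) → Bool) (hf : IsDegLeFun 3 f) (hg : IsDegLeFun 3 g)
    (u : (Fin (6 + 6) → Bool) → ℤ) (hu : ∀ x, W (fun y => signOf (g y)) x = (2 : ℝ) ^ 4 * (u x : ℝ))
    (hodd : ∃ x, Odd (u x)) : forrelation f g ≤ 936 / 1024 := by
  classical
  by_contra hΦ
  push Not at hΦ
  have hall : ∀ x, Odd (u x) := TypeOTwelve.typeO_of_exists_odd g u hg hu hodd
  have hu' : ∀ x, W (fun y => signOf (g y)) x = (2 : ℝ) ^ (2 * 2) * (u x : ℝ) := fun x => (hu x).trans (by norm_num)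
  have hd1 : IsDegLeFun 1 (fun x => decide (Odd (u x / 2))) := z2_digitOne 2 g u hg hu' hall
  have hd2 : IsDegLeFun 3 (fun x => decide (Odd (u x / 2 / 2))) := z2_digitTwo 2 g u hg hu' hall
  set E := univ.filter (fun x : Fin (6 + 6) → Bool => (Odd (u x / 2) ↔ Odd (u x / 2 / 2))) with hEdef
  have hdegE : IsDegLeFun (2 + 1) (fun x => (decide (Odd (u x / 2)) ^^ decide (Odd (u x / 2 / 2))) ^^ true) :=
    tb_isDegLeFun_xor_const (bb_isDegLeFun_bxor (hd1.mono (by norm_num)) hd2) true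
  have hsetE : (univ.filter fun x : Fin (6 + 6) → Bool =>
      ((decide (Odd (u x / 2)) ^^ decide (Odd (u x / 2 / 2))) ^^ true) = true) = E := by
    rw [hEdef]
    apply filter_congr
    intro x _
    by_cases h1 : Odd (u x / 2) <;> by_cases h2 : Odd (u x / 2 / 2) <;> simp [h1, h2]
  have hsumE : (∑ x, (if (Odd (u x / 2) ↔ Odd (u x / 2 / 2)) then 1 else 0 : ℤ)) = #E := by rw [sum_boole]
  -- `#E ≥ 768`, `#E ≠ 768`
  have hE768 : 768 ≤ #E := to15_typeO_E_ge_768 f g hf hg u hu hodd (by linarith)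
  have hEne : #E ≠ 768 := by
    intro h
    have := to15_typeO_E768_le f g hf hg u hu hodd h
    linarith
  -- budget: `4096 + 8#E ≤ Σ τ² = 2¹⁷(1 − Φ) < 11264`
  have hbud := tw12_budget f g u hu
  have hT : (∑ x, (u x - 4 * sZ (f x)) ^ 2 : ℤ) ≤ 11263 := by
    have h' : ((∑ x, (u x - 4 * sZ (f x)) ^ 2 : ℤ) : ℝ) < 11264 := by rw [hbud]; linarith
    have h'' : (∑ x, (u x - 4 * sZ (f x)) ^ 2 : ℤ) < 11264 := by exact_mod_cast h'
    omega
  choose v hv using fun x => to12_pt_mod8 (u x) (sZ (f x)) (hall x) (tp_sZ_cases (f x))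
  set τ₀ : (Fin (6 + 6) → Bool) → ℤ := fun x =>
    sZ (decide (Odd (u x / 2))) * (1 - 4 * (if (Odd (u x / 2) ↔ Odd (u x / 2 / 2)) then 1 else 0)) with hτ₀def
  have hvx : ∀ x, u x - 4 * sZ (f x) = τ₀ x + 8 * v x := fun x => hv x
  have hτ₀val : ∀ x, τ₀ x = 1 ∨ τ₀ x = -1 ∨ τ₀ x = 3 ∨ τ₀ x = -3 := by
    intro x
    simp only [τ₀]
    rcases tp_sZ_cases (decide (Odd (u x / 2))) with h | h <;> rw [h] <;> split_ifs <;> norm_num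
  have hτ₀sq : ∀ x, τ₀ x ^ 2 = 1 + 8 * (if (Odd (u x / 2) ↔ Odd (u x / 2 / 2)) then 1 else 0 : ℤ) := by
    intro x
    simp only [τ₀]
    rcases tp_sZ_cases (decide (Odd (u x / 2))) with h | h <;> rw [h] <;> split_ifs <;> norm_num
  have hsumτ₀ : ∑ x, τ₀ x ^ 2 = 4096 + 8 * #E := by
    rw [sum_congr rfl fun x _ => hτ₀sq x, sum_add_distrib, ← mul_sum, hsumE, sum_const, card_univ, Fintype.card_fun,
      Fintype.card_bool, Fintype.card_fin]
    norm_num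
  set X : (Fin (6 + 6) → Bool) → ℤ := fun x => (τ₀ x + 8 * v x) ^ 2 - τ₀ x ^ 2 with hXdef
  have hXnn : ∀ x, 0 ≤ X x := fun x => to12_excess_nonneg _ _ (hτ₀val x)
  have hTdec : (∑ x, (u x - 4 * sZ (f x)) ^ 2 : ℤ) = ∑ x, τ₀ x ^ 2 + ∑ x, X x := by
    rw [← sum_add_distrib]
    exact sum_congr rfl fun x _ => by rw [hvx x]; simp only [X]; ring
  have hXsum_nn : 0 ≤ ∑ x, X x := sum_nonneg fun x _ => hXnn x
  have hE896 : #E < 896 := by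
    rw [hTdec, hsumτ₀] at hT
    have : (8 : ℤ) * #E ≤ 7167 := by linarith
    have : 8 * #E ≤ 7167 := by exact_mod_cast this
    omega
  exact kt_gap_twelve _ hdegE (by rw [hsetE]; omega) (by rw [hsetE]; exact hE896)

end Summit.QuantumAdvantage.QuantumAdvantage.Theorems.CubicForrelation.NearExactIsExact

end
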